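import Summits.AtomisticToContinuum.HydrodynamicLimit.Theorems.TwoClocksClampedWindowDockGronwall
import Summits.AtomisticToContinuum.HydrodynamicLimit.Theorems.OneFlightGossipEngineUniformLocalGibbsConcentration
import Summits.AtomisticToContinuum.HydrodynamicLimit.Theorems.DenseExcursion.Negative.Everywhere

/-!
# `HydroLimitInBand` (stmt-AtomisticToContinuum-9133), line `IdeatorOneSketch`: the guarded Grönwall core implies the guarded Yau target

Support file for the crux `ImplosionDichotomy.HydroLimitInBand` (the packing-guarded hydrodynamic limit of
deterministic hard spheres at fixed small reduced density), line `IdeatorOneSketch` (card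
`in-band-entropy-clock`): THE GUARD COMMUTES WITH THE ENTROPY CLOCK. The line docks the crux to the GUARDED Yau
target `RelEntropyVanishingInBand` — the shared typed target `TwoClocks.RelEntropyVanishing` with the packing
guard `ρ_t(x)σ³ < η₀` on `[0,T) × 𝕋³` inserted after the Euler solution, `∃ η₀ > 0` outermost — and reduces
that target to the GUARDED GRONWALL CORE `GronwallCoreInBand`: Yau's relative-entropy estimate
`KL(lawAt Φ λ_N t ‖ localGibbsLaw σ a (u t) (θ t))/(N+1) → 0` along a HANDED-OVER explicit reference activity
`a` (`ρ_t ≤ a ≤ 2ρ_t`, `SmallDensity (profileOf a) σ`, `rhoLim (profileOf a) σ = ρ_t`), asked only for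
classical solutions whose packing stays below `η_c` on `[0,T)`.

This file is that reduction, `relEntropyVanishingInBand_of_gronwallCoreInBand`, stated in UNFOLDED form (the
two `Prop`s are spelled out as antecedent and consequent of one implication; the line's skeleton turns it into
the one-line stub `stub_reduction : GronwallCoreInBand → RelEntropyVanishingInBand`). It is the in-band twin of the landed
reductions `EntropyClockDock.clampedWindowDock_of_core` / `clampedWindowDock_of_gronwallRf` of the sibling item
`TwoClocks.ClampedWindowDock` (stmt-13735), with the single difference that the packing of `ρ_t`, there drawn
from `DiluteSelfConsistency` (stmt-3091), is here READ OFF THE GUARD of the in-band statement. Ingredients, all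
landed: the `η₀`-uniform exponential law of large numbers of local Gibbs laws
(`uniformLocalGibbsConcentration_proof`, item 14445), activity inversion in the cluster radius
(`EntropyClockDock.exists_activity_of_density`), the reference tie at fixed `σ`
(`EntropyClockDock.tie_rhoLim_of_smallDensity`), data pinning and the `t = 0` slice
(`EntropyClockDock.data_eq_of_ties`, `tie_of_expConc`, `timeZero_slice`), mass conservation and unit
admissible mass (`DenseExcursionEverywhere.integral_density_eq`, `integral_density_zero_eq_one`).

Thresholds: `η₀ := min η_c (min η₁ (η_U/2))` (`η₁` the activity-inversion threshold, `η_U` the threshold of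
`UniformLocalGibbsConcentration`), `σ₀ := min σ_c (min (1/2) (η_U ∫a₀ / sup a₀))`.

Reference: H.-T. Yau, *Relative entropy and hydrodynamics of Ginzburg–Landau models*, Lett. Math. Phys. 22
(1991), §2 (the relative-entropy method along an explicit local-equilibrium reference).
prover-line-stmt-AtomisticToContinuum-9133-0.
-/

noncomputable section

namespace Summit.AtomisticToContinuum.HydrodynamicLimit.Theorems.EntropyClockDock

open MeasureTheory Filter Set Topology InformationTheory
open scoped ENNReal
open Literature.MathematicalPhysics.KineticTheory Literature.Analysis.FluidPDE Literature.Analysis.FunctionSpaces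

/-- **The guarded Grönwall core implies the guarded Yau target** (stub `stub_reduction` of line
`IdeatorOneSketch` of the crux `HydroLimitInBand`, unfolded). Given Yau's relative-entropy estimate along every
handed-over reference activity for classical solutions of packing `< η_c` (the antecedent: the body of
`GronwallCoreInBand`), the body of `RelEntropyVanishingInBand` holds with `η₀ := min η_c (min η₁ (η_U/2))` and
`σ₀ := min σ_c (min (1/2) (η_U ∫a₀ / sup a₀))`: the probability clause by `isProbabilityMeasure_localGibbsLaw`
(`σ ≤ 1/2`); the `t = 0` slice by `timeZero_slice` (the initial activity is `η_U`-dilute by the choice of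
`σ₀`); at `0 < t < T` the guard gives `σ³ sup ρ_t ≤ η₁` and `≤ η_U/2`, mass `∫ρ_t = 1` by conservation and the
tie, so the inverted activity `a_t` of `exists_activity_of_density` exists, is `η_U`-dilute (`a_t ≤ 2ρ_t`,
`∫a_t ≥ 1`), its local Gibbs law with `(u_t, θ_t)` is a probability measure tied to
`(rhoLim (profileOf a_t) σ, u_t, θ_t) = (ρ_t, u_t, θ_t)` (`tie_rhoLim_of_smallDensity`) and concentrates
exponentially around an anonymous density pinned to `ρ_t` by `data_eq_of_ties`; the KL clause is the antecedent.
[cite: Yau1991, §2] -/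
theorem relEntropyVanishingInBand_of_gronwallCoreInBand :
    (∃ ηc : ℝ, 0 < ηc ∧ ∀ (a₀ θ₀ : T3 → ℝ) (u₀ : T3 → V3), Continuous a₀ → Continuous θ₀ → Continuous u₀ →
    (∀ x, 0 < a₀ x) → (∀ x, 0 < θ₀ x) → ∃ σ₀ : ℝ, 0 < σ₀ ∧ ∀ σ : ℝ, 0 < σ → σ < σ₀ →
    ∀ (T : ℝ) (ρ θ : ℝ → T3 → ℝ) (u : ℝ → T3 → V3), IsHardSphereEulerSolution σ T ρ u θ →
    (∀ t ∈ Set.Ico 0 T, ∀ x, ρ t x * σ ^ 3 < ηc) →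
    ∀ Φ : (N : ℕ) → HardSphereFlow (Torus.geometry (Fin 3)) (hsDiameter σ N) (N + 1),
    TendstoHydroFieldsAt (fun N => localGibbsLaw σ a₀ u₀ θ₀ N (Φ N)) Φ ρ u θ 0 →
    ∀ t ∈ Set.Ioo 0 T, ∀ (a : T3 → ℝ) (hac : Continuous a) (hap : ∀ x, 0 < a x),
      (∀ x, ρ t x ≤ a x ∧ a x ≤ 2 * ρ t x) → SmallDensity (profileOf a hac hap) σ →
      rhoLim (profileOf a hac hap) σ = ρ t →
      Tendsto (fun N : ℕ => klDiv ((Φ N).lawAt (localGibbsLaw σ a₀ u₀ θ₀ N (Φ N)) t)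
        (localGibbsLaw σ a (u t) (θ t) N (Φ N)) / ((N : ℝ≥0∞) + 1)) atTop (𝓝 0)) →
    ∃ η₀ : ℝ, 0 < η₀ ∧ ∀ (a₀ θ₀ : T3 → ℝ) (u₀ : T3 → V3), Continuous a₀ → Continuous θ₀ → Continuous u₀ →
    (∀ x, 0 < a₀ x) → (∀ x, 0 < θ₀ x) → ∃ σ₀ : ℝ, 0 < σ₀ ∧ ∀ σ : ℝ, 0 < σ → σ < σ₀ →
    ∀ (T : ℝ) (ρ θ : ℝ → T3 → ℝ) (u : ℝ → T3 → V3), IsHardSphereEulerSolution σ T ρ u θ →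
    (∀ t ∈ Set.Ico 0 T, ∀ x, ρ t x * σ ^ 3 < η₀) →
    ∀ Φ : (N : ℕ) → HardSphereFlow (Torus.geometry (Fin 3)) (hsDiameter σ N) (N + 1),
    (∀ N, IsProbabilityMeasure (localGibbsLaw σ a₀ u₀ θ₀ N (Φ N))) ∧
    (TendstoHydroFieldsAt (fun N => localGibbsLaw σ a₀ u₀ θ₀ N (Φ N)) Φ ρ u θ 0 →
      ∀ t ∈ Set.Ico 0 T, ∃ a : T3 → ℝ,
      (∀ N, IsProbabilityMeasure (localGibbsLaw σ a (u t) (θ t) N (Φ N))) ∧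
      (∀ χ : T3 → ℝ, Continuous χ → ∀ δ : ℝ, 0 < δ → ∃ C : ℝ, 0 < C ∧ ∀ N : ℕ,
        localGibbsLaw σ a (u t) (θ t) N (Φ N)
            {z | δ < |empiricalDensityField z χ - ∫ x, χ x * ρ t x|} ≤
          ENNReal.ofReal (C * Real.exp (-(C⁻¹ * (N + 1)))) ∧
        localGibbsLaw σ a (u t) (θ t) N (Φ N)
            {z | δ < ‖empiricalMomentumField z χ - ∫ x, (χ x * ρ t x) • u t x‖} ≤
          ENNReal.ofReal (C * Real.exp (-(C⁻¹ * (N + 1)))) ∧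
        localGibbsLaw σ a (u t) (θ t) N (Φ N)
            {z | δ < |empiricalEnergyField z χ -
              ∫ x, χ x * totalEnergyDensity (ρ t x) (u t x) (θ t x)|} ≤
          ENNReal.ofReal (C * Real.exp (-(C⁻¹ * (N + 1))))) ∧
      Tendsto (fun N : ℕ => klDiv ((Φ N).lawAt (localGibbsLaw σ a₀ u₀ θ₀ N (Φ N)) t)
        (localGibbsLaw σ a (u t) (θ t) N (Φ N)) / ((N : ℝ≥0∞) + 1)) atTop (𝓝 0)) := by
  rintro ⟨ηc, hηc, Hcore⟩
  -- the `η₀`-uniform exponential LLN of local Gibbs laws (item 14445, PROVED) and activity inversion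
  obtain ⟨ηU, hηU, HU⟩ := uniformLocalGibbsConcentration_proof
  obtain ⟨η₁, hη₁, Hinv⟩ := exists_activity_of_density
  refine ⟨min ηc (min η₁ (ηU / 2)), lt_min hηc (lt_min hη₁ (by positivity)),
    fun a₀ θ₀ u₀ ha hθ hu ha0 hθ0 => ?_⟩
  obtain ⟨σc, hσc, Hc⟩ := Hcore a₀ θ₀ u₀ ha hθ hu ha0 hθ0
  -- the initial activity is `ηU`-dilute for `σ ≤ min (1/2) (ηU ∫a₀ / sup a₀)`
  have hI : 0 < ∫ x, a₀ x := integral_pos_of_continuous_pos ha ha0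
  have hbdd₀ : BddAbove (Set.range a₀) := (isCompact_range ha).bddAbove
  have hSpos : 0 < ⨆ x, a₀ x := (ha0 0).trans_le (le_ciSup hbdd₀ 0)
  have hg : 0 < ηU * (∫ x, a₀ x) / ⨆ x, a₀ x := div_pos (mul_pos hηU hI) hSpos
  refine ⟨min σc (min (1 / 2) (ηU * (∫ x, a₀ x) / ⨆ x, a₀ x)),
    lt_min hσc (lt_min (by norm_num) hg), fun σ hσ hσlt T ρ θ u hE hguard Φ => ?_⟩
  have hσc' : σ < σc := hσlt.trans_le (min_le_left _ _)
  have hσ2' : σ < 1 / 2 := hσlt.trans_le ((min_le_right _ _).trans (min_le_left _ _))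
  have hσ2 : σ ≤ 1 / 2 := hσ2'.le
  have hσg : σ ≤ ηU * (∫ x, a₀ x) / ⨆ x, a₀ x :=
    (hσlt.trans_le ((min_le_right _ _).trans (min_le_right _ _))).le
  have hguard₀ : σ ^ 3 * (⨆ x, a₀ x) ≤ ηU * ∫ x, a₀ x := by
    have h31 : σ ^ 3 ≤ σ := pow_le_of_le_one hσ.le (hσ2.trans (by norm_num)) three_ne_zero
    calc σ ^ 3 * (⨆ x, a₀ x) ≤ σ * ⨆ x, a₀ x := mul_le_mul_of_nonneg_right h31 hSpos.le
      _ ≤ ηU * (∫ x, a₀ x) / (⨆ x, a₀ x) * ⨆ x, a₀ x := mul_le_mul_of_nonneg_right hσg hSpos.le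
      _ = ηU * ∫ x, a₀ x := div_mul_cancel₀ _ hSpos.ne'
  refine ⟨fun N => isProbabilityMeasure_localGibbsLaw ha hθ hu ha0 hθ0 hσ2 N (Φ N), fun htie t ht => ?_⟩
  obtain ⟨ρ₀, hρ₀c, hρ₀pos, -, hconc⟩ := HU a₀ θ₀ u₀ ha hθ hu ha0 hθ0 σ hσ hguard₀
  rcases ht.1.eq_or_lt with h0 | htpos
  · -- the `t = 0` slice: the reference IS the initial law
    subst h0
    exact timeZero_slice hσ2 ha hθ hu ha0 hθ0 hρ₀c hρ₀pos hconc hE ht.2 Φ htie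
  · -- the Euler slice at time `t`
    have hρtc : Continuous (ρ t) := (hE.smooth_density.isSmooth_slice ht).continuous
    have hutc : Continuous (u t) := (hE.smooth_velocity.isSmooth_slice ht).continuous
    have hθtc : Continuous (θ t) := (hE.smooth_temperature.isSmooth_slice ht).continuous
    have hρtpos : ∀ x, 0 < ρ t x := hE.density_pos t ht
    have hθtpos : ∀ x, 0 < θ t x := hE.temperature_pos t ht
    -- unit mass: conservation along the solution and the admissible tie at `t = 0`
    have hmass : ∫ x, ρ t x = 1 :=
      (DenseExcursionEverywhere.integral_density_eq hE ht).trans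
        (DenseExcursionEverywhere.integral_density_zero_eq_one hσ2 ha hθ hu ha0 hθ0 Φ htie)
    -- packing of `ρ_t` FROM THE GUARD (sup attained on the compact torus)
    have hpack : ∀ x, ρ t x * σ ^ 3 < min ηc (min η₁ (ηU / 2)) := fun x => hguard t ht x
    have hbdd : BddAbove (Set.range (ρ t)) := (isCompact_range hρtc).bddAbove
    obtain ⟨xM, -, hxM⟩ := isCompact_univ.exists_isMaxOn univ_nonempty hρtc.continuousOn
    have hsup : (⨆ x, ρ t x) = ρ t xM :=
      le_antisymm (ciSup_le fun x => (isMaxOn_iff.mp hxM) x (mem_univ x)) (le_ciSup hbdd xM)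
    have hpack₁ : σ ^ 3 * (⨆ x, ρ t x) ≤ η₁ := by
      rw [hsup, mul_comm]
      exact ((hpack xM).trans_le ((min_le_right _ _).trans (min_le_left _ _))).le
    have hpackU : σ ^ 3 * (⨆ x, ρ t x) ≤ ηU / 2 := by
      rw [hsup, mul_comm]
      exact ((hpack xM).trans_le ((min_le_right _ _).trans (min_le_right _ _))).le
    -- the inverted activity `a_t` (cluster radius): `ρ_t ≤ a_t ≤ 2ρ_t`, `rhoLim (profileOf a_t) σ = ρ_t`
    obtain ⟨a, hac, hap, hale, hQs, hlim⟩ := Hinv σ hσ hσ2' (ρ t) hρtc hρtpos hmass hpack₁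
    -- `ηU`-diluteness of `a_t`: `σ³ sup a_t ≤ 2 σ³ sup ρ_t ≤ ηU ≤ ηU ∫a_t`
    have haguard : σ ^ 3 * (⨆ x, a x) ≤ ηU * ∫ x, a x := by
      have hsupa : (⨆ x, a x) ≤ 2 * ⨆ x, ρ t x :=
        ciSup_le fun x => (hale x).2.trans (mul_le_mul_of_nonneg_left (le_ciSup hbdd x) zero_le_two)
      have hinta : 1 ≤ ∫ x, a x := by
        have h := integral_mono (integrable_of_continuous_T3 hρtc) (integrable_of_continuous_T3 hac)
          fun x => (hale x).1
        linarith [hmass]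
      have hσ3 : 0 ≤ σ ^ 3 := by positivity
      calc σ ^ 3 * (⨆ x, a x) ≤ σ ^ 3 * (2 * ⨆ x, ρ t x) := mul_le_mul_of_nonneg_left hsupa hσ3
        _ = 2 * (σ ^ 3 * ⨆ x, ρ t x) := by ring
        _ ≤ 2 * (ηU / 2) := by gcongr
        _ = ηU * 1 := by ring
        _ ≤ ηU * ∫ x, a x := mul_le_mul_of_nonneg_left hinta hηU.le
    -- the reference tie at fixed `σ`: the local Gibbs laws of `(a_t, u_t, θ_t)` are tied to `(ρ_t, u_t, θ_t)`
    have hatie : TendstoHydroFieldsAt (fun N => localGibbsLaw σ a (u t) (θ t) N (Φ N)) Φ (fun _ => ρ t)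
        (fun _ => u t) (fun _ => θ t) 0 := by
      have h := tie_rhoLim_of_smallDensity (u₀ := u t) hac hθtc hutc hap hθtpos hσ2 hQs Φ
      simp only [hlim] at h
      exact h
    -- exponential concentration of the reference; its anonymous LLN density `ρ₁` is pinned to `ρ_t`
    obtain ⟨ρ₁, hρ₁c, hρ₁pos, hprob, hconc₁⟩ := HU a (θ t) (u t) hac hθtc hutc hap hθtpos σ hσ haguard
    obtain ⟨hρt, -, -⟩ := data_eq_of_ties hσ2 Φ hac hθtc hutc hap hθtpos hρ₁c hρ₁pos
      (tie_of_expConc Φ hconc₁) (ρ := fun _ => ρ t) (u := fun _ => u t) (θ := fun _ => θ t)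
      hρtc hutc hθtc hatie
    -- the KL clause is the guarded Grönwall core (packing `< η_c` on `[0,T)` from the guard)
    refine ⟨a, fun N => hprob N (Φ N), fun χ hχ δ hδ => ?_,
      Hc σ hσ hσc' T ρ θ u hE (fun s hs x => (hguard s hs x).trans_le (min_le_left _ _)) Φ htie t
        ⟨htpos, ht.2⟩ a hac hap hale hQs hlim⟩
    obtain ⟨C, hC, hN⟩ := hconc₁ χ hχ δ hδ
    exact ⟨C, hC, fun N => by rw [hρt]; exact hN N (Φ N)⟩

end Summit.AtomisticToContinuum.HydrodynamicLimit.Theorems.EntropyClockDock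

end
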